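import Summits.ValiantsHypothesis.ValiantsHypothesis.Theorems.VPBoundarySquareNbLevelExpansion
import HarnessLib

/-!
# W18 converse series, FILE 4a «SPECIALISED COEFFICIENTS» (O-L3-18)

INFRASTRUCTURE ONLY. For a SPECIALISATION PATTERN `kind : Var n → σ ⊕ F` (generic variable ↦
target variable `inl y` or scalar `inr c`; `spz kind` is the substitution `X y` / `C c`, the shape
`IsVNPnbFamily.exists_specialisation` delivers) the number
`specCoeff kind m t ν := coeff ν (aeval (spz kind) E_m(t))` — a coefficient of Bürgisser's level
expansion (FILE 2a `levelExpand`) after specialisation — obeys the NUMERIC level recursion (★)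
`specCoeff (m+1) t ν = Σ_{α,β ⊢ t_{n+m+1}} mult α · mult β · levelCst(α,β) · [levelExp(α,β) ≤ ν] ·
specCoeff m (t+α+β) (ν − levelExp(α,β))` (`specCoeff_succ`), with the input monomial at the bottom
(`specCoeff_zero`), the coefficients of the specialised generic computation at the top
(`coeff_aeval_spz_genericComputation`) and, for a pattern into `τ ⊕ Fin u`, the coefficients of the
Boolean sum as the sum over `e` of the Boolean patterns (`coeff_boolSum_aeval_spz_genericComputation`).
(★) is the contract the gadget level (4b) and the level product (4c) of the series implement.
HONESTY: pure algebra; FILE 4a of 4a/4b/4c; nothing about VP / VNP / VPnb / VNPnb / B_nb /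
binomTable ∈ VNP is proved; 0 S-currency; rung 0; `VP ≠ VNP` is proved by nothing in this series.
-/

set_option linter.dupNamespace false

noncomputable section

namespace Summit.ValiantsHypothesis.ValiantsHypothesis.Theorems.VPBoundarySquareNbSpecCoeff

open MvPolynomial Finset Literature.Computability.AlgebraicComplexity
open Literature.Computability.AlgebraicComplexity.MalodGeneric
open Summit.ValiantsHypothesis.ValiantsHypothesis.Theorems.VPBoundarySquareNbLevelExpansion

variable {F : Type*} [CommRing F] {σ : Type*} (n : ℕ)

/-! ## §1 Specialisation patterns -/

/-- The substitution of a pattern: `inl y ↦ X y`, `inr c ↦ C c` (the shape "`φ i = X x` or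
`φ i = C c`" of `IsVNPnbFamily.exists_specialisation`, made a function).
[cite: Burgisser2024Completeness, §4.2 (p0016 L8–L11)] -/
def spz (kind : Var n → σ ⊕ F) : Var n → MvPolynomial σ F := fun v => Sum.elim X C (kind v)

/-- Scalar weight of a slot raised to the power `d`: `1` for a variable slot, `c ^ d` for a scalar.
[folklore] -/
def cw (a : σ ⊕ F) (d : ℕ) : F := Sum.elim (fun _ => 1) (fun c => c ^ d) a

/-- Exponent vector of a slot raised to the power `d`: `d·δ_y` for a variable slot `y`, `0` for a
scalar. [folklore] -/
def ve (a : σ ⊕ F) (d : ℕ) : σ →₀ ℕ := Sum.elim (fun y => Finsupp.single y d) (fun _ => 0) a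

/-- A power of one generic variable specialises to `C (weight) · X^(exponent vector)`. [folklore] -/
theorem aeval_spz_X_pow (kind : Var n → σ ⊕ F) (v : Var n) (d : ℕ) :
    aeval (spz n kind) ((X v : MvPolynomial (Var n) F) ^ d) =
      C (cw (kind v) d) * monomial (ve (kind v) d) 1 := by
  rw [map_pow, aeval_X]
  simp only [spz, cw, ve]
  cases kind v with
  | inl y => simp only [Sum.elim_inl, C_1, one_mul, X_pow_eq_monomial]
  | inr c =>
    simp only [Sum.elim_inr, C_pow]
    rw [← C_apply, C_1, mul_one]

/-- … and so does a product of powers (weights multiply, exponent vectors add). [folklore] -/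
theorem aeval_spz_prod_X_pow (kind : Var n → σ ⊕ F) {ι : Type*} (s : Finset ι) (v : ι → Var n)
    (d : ι → ℕ) :
    aeval (spz n kind) (∏ i ∈ s, (X (v i) : MvPolynomial (Var n) F) ^ d i) =
      C (∏ i ∈ s, cw (kind (v i)) (d i)) * monomial (∑ i ∈ s, ve (kind (v i)) (d i)) 1 := by
  classical
  induction s using Finset.induction_on with
  | empty => rw [prod_empty, prod_empty, sum_empty, map_one, C_1, one_mul, ← C_apply, C_1]
  | insert i s hi ih =>
    rw [prod_insert hi, prod_insert hi, sum_insert hi, map_mul (aeval (spz n kind)), ih,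
      aeval_spz_X_pow, C_mul,
      show monomial (ve (kind (v i)) (d i) + ∑ j ∈ s, ve (kind (v j)) (d j)) (1 : F) =
          monomial (ve (kind (v i)) (d i)) 1 * monomial (∑ j ∈ s, ve (kind (v j)) (d j)) 1 by
        rw [monomial_mul, one_mul]]
    ring

/-! ## §2 The level data and the specialised coefficient -/

/-- Scalar weight of the level monomial `a_{m+1}^α b_{m+1}^β` under the pattern.
[cite: Burgisser2024Completeness, §4.2 (4.5)–(4.6) (p0016 L63–L102)] -/
def levelCst (kind : Var n → σ ⊕ F) (m : ℕ) (α β : ℕ → ℕ) : F :=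
  ∏ q ∈ range (n + m + 1),
    (cw (kind (coefIdx n (m + 1) q false)) (α q) * cw (kind (coefIdx n (m + 1) q true)) (β q))

/-- Exponent vector of the level monomial `a_{m+1}^α b_{m+1}^β` under the pattern.
[cite: Burgisser2024Completeness, §4.2 (4.5)–(4.6) (p0016 L63–L102)] -/
def levelExp (kind : Var n → σ ⊕ F) (m : ℕ) (α β : ℕ → ℕ) : σ →₀ ℕ :=
  ∑ q ∈ range (n + m + 1),
    (ve (kind (coefIdx n (m + 1) q false)) (α q) + ve (kind (coefIdx n (m + 1) q true)) (β q))

/-- Scalar weight of the input monomial `x_1^{t_1} ⋯ x_n^{t_n}` under the pattern.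
[cite: Burgisser2024Completeness, §4.2 (p0016 L73–L76)] -/
def inputCst (kind : Var n → σ ⊕ F) (t : ℕ → ℕ) : F :=
  ∏ q ∈ range n, cw (kind (Sum.inl (Fin.ofNat (n + 1) (q + 1)))) (t (q + 1))

/-- Exponent vector of the input monomial `x_1^{t_1} ⋯ x_n^{t_n}` under the pattern.
[cite: Burgisser2024Completeness, §4.2 (p0016 L73–L76)] -/
def inputExp (kind : Var n → σ ⊕ F) (t : ℕ → ℕ) : σ →₀ ℕ :=
  ∑ q ∈ range n, ve (kind (Sum.inl (Fin.ofNat (n + 1) (q + 1)))) (t (q + 1))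

/-- **The specialised coefficient** `coeff ν (aeval (spz kind) E_m(t))` of the level expansion.
[cite: Burgisser2024Completeness, §4.2 (4.5)–(4.6) (p0016 L63–L102)] -/
def specCoeff (kind : Var n → σ ⊕ F) (m : ℕ) (t : ℕ → ℕ) (ν : σ →₀ ℕ) : F :=
  coeff ν (aeval (spz n kind) (levelExpand F n m t))

/-- The level monomial specialises to `C (levelCst) · X^(levelExp)`.
[cite: Burgisser2024Completeness, §4.2 (p0016 L78–L82)] -/
theorem aeval_spz_levelMon (kind : Var n → σ ⊕ F) (m : ℕ) (α β : ℕ → ℕ) :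
    aeval (spz n kind) (levelMon F n m α β) =
      C (levelCst n kind m α β) * monomial (levelExp n kind m α β) 1 := by
  have hsplit : levelMon F n m α β =
      (∏ q ∈ range (n + m + 1), (X (coefIdx n (m + 1) q false) : MvPolynomial (Var n) F) ^ α q) *
        ∏ q ∈ range (n + m + 1), (X (coefIdx n (m + 1) q true) : MvPolynomial (Var n) F) ^ β q :=
    prod_mul_distrib
  rw [hsplit, map_mul, aeval_spz_prod_X_pow, aeval_spz_prod_X_pow, levelCst, levelExp,
    prod_mul_distrib, sum_add_distrib, C_mul,
    show monomial ((∑ q ∈ range (n + m + 1), ve (kind (coefIdx n (m + 1) q false)) (α q)) +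
          ∑ q ∈ range (n + m + 1), ve (kind (coefIdx n (m + 1) q true)) (β q)) (1 : F) =
        monomial (∑ q ∈ range (n + m + 1), ve (kind (coefIdx n (m + 1) q false)) (α q)) 1 *
          monomial (∑ q ∈ range (n + m + 1), ve (kind (coefIdx n (m + 1) q true)) (β q)) 1 by
      rw [monomial_mul, one_mul]]
  ring

/-! ## §3 The recursion (★) -/

/-- Bottom of (★): the input monomial contributes `inputCst` at exponent vector `inputExp` and
nothing elsewhere. [cite: Burgisser2024Completeness, §4.2 (p0016 L73–L76)] -/
theorem specCoeff_zero [DecidableEq σ] (kind : Var n → σ ⊕ F) (t : ℕ → ℕ) (ν : σ →₀ ℕ) :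
    specCoeff n kind 0 t ν = if inputExp n kind t = ν then inputCst n kind t else 0 := by
  unfold specCoeff inputCst inputExp
  rw [levelExpand_zero, aeval_spz_prod_X_pow, coeff_C_mul, coeff_monomial, mul_ite, mul_one,
    mul_zero]

/-- **(★) One level**: the specialised coefficient obeys the level recursion of `E` — the level
monomial's scalar weight comes out, its exponent vector is subtracted from the demand `ν`.
[cite: Burgisser2024Completeness, §4.2 (4.5)–(4.6) (p0016 L63–L102)] -/
theorem specCoeff_succ (kind : Var n → σ ⊕ F) (m : ℕ) (t : ℕ → ℕ) (ν : σ →₀ ℕ) :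
    specCoeff n kind (m + 1) t ν =
      ∑ α ∈ (range (n + m + 1)).piAntidiag (t (n + m + 1)),
        ∑ β ∈ (range (n + m + 1)).piAntidiag (t (n + m + 1)),
          ((Nat.multinomial (range (n + m + 1)) α * Nat.multinomial (range (n + m + 1)) β : ℕ) : F) *
            (levelCst n kind m α β *
              if levelExp n kind m α β ≤ ν then
                specCoeff n kind m (t + α + β) (ν - levelExp n kind m α β) else 0) := by
  unfold specCoeff
  rw [levelExpand_succ, map_sum, coeff_sum]
  refine sum_congr rfl fun α _ => ?_
  rw [map_sum, coeff_sum]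
  refine sum_congr rfl fun β _ => ?_
  rw [map_mul, map_mul, map_natCast, aeval_spz_levelMon, ← map_natCast C, mul_assoc (C _),
    ← mul_assoc (C _), ← C_mul, coeff_C_mul, coeff_monomial_mul', one_mul, mul_assoc]

/-- Top of (★): the coefficients of the specialised generic computation `G_n = E_n(δ_{2n})`.
[cite: Burgisser2024Completeness, §4.2 (4.5)–(4.6) (p0016 L63–L102)] -/
theorem coeff_aeval_spz_genericComputation (kind : Var n → σ ⊕ F) (ν : σ →₀ ℕ) :
    coeff ν (aeval (spz n kind) (genericComputation F n)) =
      specCoeff n kind n (Pi.single (2 * n) 1) ν := by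
  rw [specCoeff, genericComputation_eq_levelExpand]

/-- In (★) every `α q`, `β q` is at most the demand `t (n + m + 1)` it splits (bit-size control
for the Boolean workspace of the series). [folklore] -/
theorem le_of_mem_piAntidiag {s : Finset ℕ} {T : ℕ} {α : ℕ → ℕ} (h : α ∈ s.piAntidiag T)
    (q : ℕ) : α q ≤ T := by
  rw [mem_piAntidiag] at h
  obtain ⟨hs, hsupp⟩ := h
  by_cases hq : α q = 0
  · rw [hq]; exact Nat.zero_le _
  · rw [← hs]; exact single_le_sum (fun i _ => Nat.zero_le (α i)) (hsupp q hq)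

/-- `E_m(t)` only reads the demand `t` on the window `range (n + m + 1)` (the bit workspace of the
series stores exactly that window, while (★) passes `t + α + β` with a stale entry at `n + m + 1`).
[cite: Burgisser2024Completeness, §4.2 (4.5)–(4.6) (p0016 L63–L102)] -/
theorem levelExpand_congr (m : ℕ) {t t' : ℕ → ℕ} (h : ∀ q, q < n + m + 1 → t q = t' q) :
    levelExpand F n m t = levelExpand F n m t' := by
  induction m generalizing t t' with
  | zero =>
    rw [levelExpand_zero, levelExpand_zero]
    exact prod_congr rfl fun q hq => by
      rw [h (q + 1) (by have := mem_range.mp hq; omega)]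
  | succ m ih =>
    rw [levelExpand_succ, levelExpand_succ, h (n + m + 1) (by omega)]
    refine sum_congr rfl fun α _ => sum_congr rfl fun β _ => ?_
    rw [ih (t := t + α + β) (t' := t' + α + β) fun q hq => by
      simp only [Pi.add_apply, h q (by omega)]]

/-- … hence so does the specialised coefficient. [folklore] -/
theorem specCoeff_congr (kind : Var n → σ ⊕ F) (m : ℕ) {t t' : ℕ → ℕ}
    (h : ∀ q, q < n + m + 1 → t q = t' q) (ν : σ →₀ ℕ) :
    specCoeff n kind m t ν = specCoeff n kind m t' ν := by
  rw [specCoeff, specCoeff, levelExpand_congr n m h]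

/-! ## §4 From "`φ i = X x` or `φ i = C c`" to patterns; Boolean sums -/

/-- A substitution by variables-or-constants IS the substitution of a pattern.
[cite: Burgisser2024Completeness, §4.2 (p0016 L8–L11)] -/
theorem exists_kind_eq_spz {ρ : Type*} (φ : Var n → MvPolynomial ρ F)
    (hφ : ∀ i, (∃ x, φ i = X x) ∨ ∃ c, φ i = C c) : ∃ kind : Var n → ρ ⊕ F, φ = spz n kind := by
  classical
  refine ⟨fun i => if h : ∃ x, φ i = X x then Sum.inl h.choose
      else Sum.inr ((hφ i).resolve_left h).choose, funext fun i => ?_⟩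
  by_cases h : ∃ x, φ i = X x
  · simp only [spz, dif_pos h, Sum.elim_inl]; exact h.choose_spec
  · simp only [spz, dif_neg h, Sum.elim_inr]; exact ((hφ i).resolve_left h).choose_spec

/-- Setting the last `u` target variables to the Boolean point `e` turns a pattern into
`τ ⊕ Fin u` into a pattern into `τ` (the Boolean values become scalars `0`/`1`). [folklore] -/
def kindBool {τ : Type*} {u : ℕ} (kind : Var n → (τ ⊕ Fin u) ⊕ F) (e : Fin u → Bool) :
    Var n → τ ⊕ F := fun v =>
  Sum.elim (Sum.elim (fun y => Sum.inl y) fun j => Sum.inr (if e j then 1 else 0))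
    (fun c => Sum.inr c) (kind v)

/-- Evaluating the Boolean variables after a pattern = the Boolean pattern. [folklore] -/
theorem aeval_boolPoint_spz {τ : Type*} {u : ℕ} (kind : Var n → (τ ⊕ Fin u) ⊕ F)
    (e : Fin u → Bool) (G : MvPolynomial (Var n) F) :
    aeval (Sum.elim X fun j => if e j then (1 : MvPolynomial τ F) else 0) (aeval (spz n kind) G) =
      aeval (spz n (kindBool n kind e)) G := by
  have hfun : (fun v => aeval (Sum.elim X fun j => if e j then (1 : MvPolynomial τ F) else 0)
      (spz n kind v)) = spz n (kindBool n kind e) := funext fun v => by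
    simp only [spz, kindBool]
    rcases kind v with (y | j) | c
    · simp
    · simp [apply_ite C]
    · simp
  rw [← AlgHom.comp_apply, comp_aeval, hfun]

/-- **Coefficients of a Boolean sum of a specialised generic computation** = the sum over the
Boolean points `e` of the top of (★) for the Boolean patterns.
[cite: Burgisser2024Completeness, §4.2 (p0016 L8–L11), Rem. 4.9 (p0017 L54–L60)] -/
theorem coeff_boolSum_aeval_spz_genericComputation {τ : Type*} {u : ℕ}
    (kind : Var n → (τ ⊕ Fin u) ⊕ F) (μ : τ →₀ ℕ) :
    coeff μ (boolSum (aeval (spz n kind) (genericComputation F n))) =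
      ∑ e : Fin u → Bool, specCoeff n (kindBool n kind e) n (Pi.single (2 * n) 1) μ := by
  unfold boolSum
  rw [coeff_sum]
  exact sum_congr rfl fun e _ => by
    rw [aeval_boolPoint_spz, coeff_aeval_spz_genericComputation]

end Summit.ValiantsHypothesis.ValiantsHypothesis.Theorems.VPBoundarySquareNbSpecCoeff
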